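import Mathlib
import HarnessLib
import Summits.NavierStokesRegularity.NavierStokesRegularity.Theorems.UnthreadedDoorAntidynamoWallSymmetricCoreMild

/-!
# Route `UnthreadedDoor` / `ThreadingFlux`, crux `PoloidalLiouville` (stmt-NavierStokesRegularity-1222), antidynamo v2 skeleton (sha16 `4ebf5683127b`),
# WALL `stub_scalarLiouville`: NORMAL FORM OF THE SYMMETRIC CORES — a Galilean image, with frame path AND drift inside `Fix R`, of a MILD solution exactly
# `R`-equivariant about the origin

Support file (seat leafhand-ns-unthreadeddoor-2 g2, cell decomp-ns), `--supports stmt-NavierStokesRegularity-1222 --as helper`; theorems only.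

Companion of `…WallSymmetricCoreMild` (the case `Fix R = 0`).  For a GENERAL linear isometry `R` (mirror: `Fix R` a plane; `Cₙ`-rotation: `Fix R` the axis):

* ★★★ `curl_eq_zero_or_symmetric_normalForm_of_curl_symmetric_slice` — if the vorticity of a flow of the wall's class is `R`-symmetric (pseudovector) about
  SOME centre at ONE instant, then EITHER `curl v ≡ 0` OR there are a bounded ancient MILD solution `W` (continuous, uniformly bounded, weakly divergence-free
  slices, Oseen integral identity for all `s < t < 0`) which is EXACTLY `R`-equivariant about the origin (`R (W(t, R⁻¹y)) = W(t, y)`), and paths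
  `γ, κ : (−∞,0) → Fix R` (`R γ(t) = γ(t)`, `R κ(t) = κ(t)`), with `v(t, x) = W(t, x − x₀ − γ(t)) + κ(t)` for all `t < 0`, `x`.
  [As in the `Fix R = 0` file: two centres of equivariance force a translation symmetry of the vorticity by `(R − 1)(q(t) − x₀)`, which must vanish
  (`curl_eq_zero_of_curl_translate_slice`), so `q(t) − x₀ ∈ Fix R` and the drift `κ(t) ∈ Fix R`.]

MEANING FOR THE WALL: the mirror core moves and drifts only INSIDE its mirror plane, the `Cₙ` core only ALONG its axis; modulo these motions every symmetric
core is a statement about print's mild class.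

HONEST LABEL: assembly over landed theorems; nothing here proves `stub_scalarLiouville`, `PoloidalLiouville` (1222), or bears on Navier–Stokes regularity; no
summit statement is proved. [folklore] [cite: KochNadirashviliSereginSverak2009, §1 p. 3, §4 (i)–(ii), Thm 5.2 (arXiv:0709.3599 pp. 3, 8–10); LemarieRieusset2016, Thm. 9.12]
-/

noncomputable section

-- the summit and its single sub-problem share the name (CONVENTIONS §1)
set_option linter.dupNamespace false

open scoped Topology InnerProductSpace RealInnerProductSpace ContDiff
open Filter Set Function Metric MeasureTheory
open Literature.Analysis Literature.Analysis.FluidPDE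

namespace Summit.NavierStokesRegularity.NavierStokesRegularity.Theorems.PoloidalLiouville.Antidynamo

open Summit.NavierStokesRegularity.NavierStokesRegularity.Theorems.PoloidalLiouville.NetFlux (E3)

namespace OneInstant

/-- ★★★ **NORMAL FORM OF THE SYMMETRIC CORES.**  Let `v` be a bounded ancient mild solution (`ν = 1`, duality class) with measurable slices, jointly smooth
on `(−∞,0) × ℝ³`, with vorticity tangent to the spheres about `x₀`, and suppose the vorticity is `R`-symmetric as a pseudovector about some centre `x₁` at ONE
instant `t₁ < 0`.  Then EITHER `curl v ≡ 0`, OR `v(t, x) = W(t, x − x₀ − γ(t)) + κ(t)` with `W` a bounded ancient MILD solution exactly `R`-equivariant about the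
origin and `γ(t), κ(t) ∈ Fix R` for all `t < 0`. [cite: KochNadirashviliSereginSverak2009, §1 p. 3, §4 (i)–(ii) (arXiv:0709.3599 pp. 3, 8); LemarieRieusset2016, Thm. 9.12] -/
theorem curl_eq_zero_or_symmetric_normalForm_of_curl_symmetric_slice
    (v : ℝ → EuclideanSpace ℝ (Fin 3) → EuclideanSpace ℝ (Fin 3)) (x₀ : EuclideanSpace ℝ (Fin 3))
    (hB : Literature.Analysis.FluidPDE.IsBoundedAncientMildSolution 1 v)
    (hm : ∀ t < 0, AEStronglyMeasurable (v t) volume)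
    (hsm : ContDiffOn ℝ (⊤ : ℕ∞) (Function.uncurry v) (Set.Iio 0 ×ˢ Set.univ))
    (hun : ∀ t < 0, ∀ x, ⟪x - x₀, curl (v t) x⟫ = 0)
    (R : EuclideanSpace ℝ (Fin 3) ≃ₗᵢ[ℝ] EuclideanSpace ℝ (Fin 3))
    (x₁ : EuclideanSpace ℝ (Fin 3)) {t₁ : ℝ} (ht₁ : t₁ < 0)
    (hsym₁ : ∀ y, curl (v t₁) (x₁ + R y) =
      (R : EuclideanSpace ℝ (Fin 3) →L[ℝ] EuclideanSpace ℝ (Fin 3)).det • R (curl (v t₁) (x₁ + y))) :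
    (∀ t < 0, ∀ x, curl (v t) x = 0) ∨
      ∃ (W : ℝ → EuclideanSpace ℝ (Fin 3) → EuclideanSpace ℝ (Fin 3)) (γ κ : ℝ → EuclideanSpace ℝ (Fin 3)),
        ContinuousOn (Function.uncurry W) (Set.Iio 0 ×ˢ Set.univ) ∧
        (∃ K : ℝ, ∀ t < 0, ∀ y, ‖W t y‖ ≤ K) ∧
        (∀ s t : ℝ, s < t → t < 0 → ∀ y,
          W t y = UnboundedOperators.heatExtension (W s) (t - s) y - oseenDuhamel 1 s W W t y) ∧
        (∀ t < 0, ∀ y, R (W t (R.symm y)) = W t y) ∧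
        (∀ t < 0, R (γ t) = γ t ∧ R (κ t) = κ t) ∧
        ∀ t < 0, ∀ x, v t x = W t (x - x₀ - γ t) + κ t := by
  by_cases h0 : ∀ t < 0, ∀ x, curl (v t) x = 0
  · exact Or.inl h0
  right
  have hsm' : IsSmoothSpaceTimeOn (Iio 0) v := hsm
  -- ## exact equivariance about `x₀` at every time, and symmetric vorticity about `x₀` at `t₁`
  have hsymAll := (curl_eq_zero_or_curl_symmetric_of_curl_symmetric_slice v x₀ hB hm hsm hun R x₁ ht₁ hsym₁).resolve_left h0
  have heqv : ∀ t < 0, ∀ y, v t (x₀ + R y) = R (v t (x₀ + y)) :=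
    (curl_eq_zero_or_equivariant_of_curl_symmetric v x₀ hB hm hsm hun R hsymAll).resolve_left h0
  -- ## the Oseen gauge, everywhere
  obtain ⟨w, A, c, -, hwc, ⟨K, hK⟩, hwdiv, hwmild, -, hrep⟩ := Theorems.oseen_gauge_of_aestronglyMeasurable v hB hm
  have hrep' : ∀ s < 0, ∀ y, v s y = w s (y - A s) + c s :=
    fun s hs y => CellFlux.galilean_rep_everywhere hsm.continuousOn hwc hrep hs y
  have hws : ∀ s < 0, w s = fun y => v s (y + A s) - c s := fun s hs => by
    funext y
    have h := hrep' s hs (y + A s)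
    rw [add_sub_cancel_right] at h
    rw [h, add_sub_cancel_right]
  have hw_smooth : ∀ s < 0, ContDiff ℝ (⊤ : ℕ∞) (w s) := fun s hs => by
    rw [hws s hs]
    exact ((hsm'.contDiff_slice hs).comp (contDiff_id.add contDiff_const)).sub contDiff_const
  have hw_curl : ∀ s < 0, ∀ y, curl (w s) y = curl (v s) (y + A s) := fun s hs y => by
    rw [hws s hs, CellFlux.curl_comp_add_sub_const]
  -- ## the slice at `t₁`: symmetric curl about `p₀ = x₀ − A t₁`, hence exactly equivariant up to `k`
  set p₀ : E3 := x₀ - A t₁ with hp₀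
  have hw2 : ContDiff ℝ 2 (w t₁) := (hw_smooth t₁ ht₁).of_le (by norm_cast)
  have hw1 : ContDiff ℝ 1 (w t₁) := (hw_smooth t₁ ht₁).of_le (by norm_cast)
  have hwdiv₁ : VectorCalculus.IsDivFree (w t₁) := (hwdiv t₁ ht₁).isDivFree_of_contDiff hw1
  have hsymw : ∀ y, curl (w t₁) (p₀ + R y) =
      (R : EuclideanSpace ℝ (Fin 3) →L[ℝ] EuclideanSpace ℝ (Fin 3)).det • R (curl (w t₁) (p₀ + y)) := fun y => by
    rw [hw_curl t₁ ht₁, hw_curl t₁ ht₁]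
    have e1 : p₀ + R y + A t₁ = x₀ + R y := by rw [hp₀]; abel
    have e2 : p₀ + y + A t₁ = x₀ + y := by rw [hp₀]; abel
    rw [e1, e2]
    exact hsymAll t₁ ht₁ y
  set k : E3 := w t₁ p₀ with hk
  have hk₁ : ∀ y, R (w t₁ (p₀ + R.symm y) - k) = w t₁ (p₀ + y) - k :=
    conj_sub_centre_eq_of_curl_symmetric hw2 (fun y => hK t₁ ht₁ y) hwdiv₁ R p₀ hsymw
  -- ## the boosted representative `W♭` is exactly equivariant about the FIXED point `p₀` at every time
  obtain ⟨hcb, hbb, hmb⟩ := oseenAncient_boost hwc ⟨K, hK⟩ hwdiv hwmild k t₁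
  have hconj := conj_eq_boost_of_slice hwc ⟨K, hK⟩ hwdiv hwmild R ht₁ hk₁
  -- ## `v t − κ t = W♭ t (· − δ t)`
  set q : ℝ → E3 := fun t => p₀ + (A t + (t - t₁) • k) with hq
  set κ : ℝ → E3 := fun t => k + c t with hκ
  have hvW : ∀ t < 0, ∀ z, v t (q t + z) - κ t = (fun t y => w t (y + (t - t₁) • k) - k) t (p₀ + z) := by
    intro t ht z
    simp only [hκ, hq]
    rw [hrep' t ht]
    have e1 : p₀ + (A t + (t - t₁) • k) + z - A t = p₀ + z + (t - t₁) • k := by abel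
    rw [e1]
    abel
  -- ## two centres of equivariance ⇒ a translation symmetry up to a constant
  have htrans : ∀ t < 0, ∀ z, v t (z + (x₀ + R (q t - x₀) - q t)) = v t z - κ t + R (κ t) := by
    intro t ht z
    -- `v t (q + y) − κ = R (v t (q + R⁻¹ y) − κ)` with `y = z − q`
    have h1 : v t z - κ t = R (v t (q t + R.symm (z - q t)) - κ t) := by
      have h := hconj t ht (z - q t)
      rw [← hvW t ht, ← hvW t ht, add_sub_cancel] at h
      exact h.symm
    -- `R (v t (x₀ + y')) = v t (x₀ + R y')` with `y' = q − x₀ + R⁻¹ (z − q)`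
    have h2 : R (v t (q t + R.symm (z - q t))) = v t (z + (x₀ + R (q t - x₀) - q t)) := by
      have h := heqv t ht (q t - x₀ + R.symm (z - q t))
      have e1 : x₀ + (q t - x₀ + R.symm (z - q t)) = q t + R.symm (z - q t) := by abel
      have e2 : x₀ + R (q t - x₀ + R.symm (z - q t)) = z + (x₀ + R (q t - x₀) - q t) := by
        rw [map_add, LinearIsometryEquiv.apply_symm_apply]
        abel
      rw [e1, e2] at h
      exact h.symm
    rw [h1, map_sub R (v t (q t + R.symm (z - q t))) (κ t), h2]
    abel
  -- ## the translation vector vanishes (else the vorticity is translation invariant at one instant), hence `q t = x₀` and `κ t = 0`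
  have hd : ∀ t < 0, x₀ + R (q t - x₀) - q t = 0 := by
    intro t ht
    by_contra hne
    refine h0 (curl_eq_zero_of_curl_translate_slice v x₀ hB hm hsm hun ⟨t, ht, _, hne, fun y => ?_⟩)
    have e : (fun y => v t (y + (x₀ + R (q t - x₀) - q t))) = fun y => v t y + (R (κ t) - κ t) := by
      funext y
      rw [htrans t ht y]
      abel
    have h := congrArg (fun f => curl f y) e
    beta_reduce at h
    rw [curl_eq_curlCLM, fderiv_comp_add_right, ← curl_eq_curlCLM] at h
    rw [h, curl_eq_curlCLM, curl_eq_curlCLM, fderiv_add_const]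
  have hγ : ∀ t < 0, R (q t - x₀) = q t - x₀ := fun t ht => by
    have h := hd t ht
    rw [sub_eq_zero] at h
    calc R (q t - x₀) = (x₀ + R (q t - x₀)) - x₀ := by abel
      _ = q t - x₀ := by rw [h]
  have hκ : ∀ t < 0, R (κ t) = κ t := fun t ht => by
    have h := htrans t ht x₀
    rw [hd t ht, add_zero] at h
    calc R (κ t) = (v t x₀ - κ t + R (κ t)) - v t x₀ + κ t := by abel
      _ = κ t := by rw [← h]; abel
  -- ## the normal form: `W = W♭(· + p₀)` is mild and exactly equivariant about the origin
  obtain ⟨hcW, hbW, hmW⟩ := oseenAncient_translate hcb hbb hmb p₀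
  refine ⟨fun t y => (fun t y => w t (y + (t - t₁) • k) - k) t (y + p₀), fun t => q t - x₀, κ, hcW, hbW, hmW,
    fun t ht y => ?_, fun t ht => ⟨hγ t ht, hκ t ht⟩, fun t ht x => ?_⟩
  · have h := hconj t ht y
    simp only at h ⊢
    rw [add_comm (R.symm y) p₀, add_comm y p₀]
    exact h
  · have h := hvW t ht (x - q t)
    rw [add_sub_cancel] at h
    simp only at h ⊢
    have e : x - x₀ - (q t - x₀) + p₀ = p₀ + (x - q t) := by abel
    rw [e, ← h]
    abel

end OneInstant

end Summit.NavierStokesRegularity.NavierStokesRegularity.Theorems.PoloidalLiouville.Antidynamo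

end
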